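import Summits.QuantumFields.YangMills.Theorems.BalabanUVNodesN08HaarCompatibilityGuardCrossing

/-!
# BalabanUVNodes ∕ N08 — THE SMALL-FIELD GUARD OF ONE COARSE BOND COSTS A PRODUCT: the conjugated off-axis crossing loop variables of (0.4) are
# I.I.D. HAAR under `dU`, so `dU{Small ℰ · c} ≤ Haar{dist1 < δ}^(L^{d−1} − 1)` and the typed E6′ defect is `≤ #PBond · Haar{dist1 < δ}^(L^{d−1} − 1)`

WIDTH SEAT `pub-ymgap-dag-n08-w3` g2, plan `W-SEAT-START-LIST.md` v7 §n08 item 3 PART 7 (sequel of `…N08HaarCompatibilityGuardCrossing`, the lattice half;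
the quantitative sharpening of part 6 p594625 `…N08HaarCompatibilityGuard` §3), 2026-08-28.  Track A, DAG node N08 = [Balaban1985UV3] Thm 1 p. 257 (compact)
+ Thm 2 p. 272; key item K1⁷ `StabilityBAtRecordR13SepCoPH` (stmt-QuantumFields-20542), `--supports … --as helper`.  COUNT-NEUTRAL.

THE POINT.  Part 6 bounded the guard of one coarse bond `c = ⟨y, y + e_μ⟩` by ONE loop variable (`dU{Small_c} ≤ h := Haar{dist1 < δ}`), which makes
`dU(guard) ≤ #PBond · h` vacuous on fine lattices.  The small-field domain of [Balaban1987RG1] (0.4) p. 253 constrains, among its `(d!)²·L^d` loop variables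
`U(Γ ∪ [x,x′] ∪ (−Γ′) ∪ (−c))`, the ones through the OFF-AXIS points `x = emb y + n`, `n_μ = 0`, `n⊥ ≠ 0` (index `(r, 1, 1)`); the lattice half shows each
of these loops factorises as `X · U(q_n) · Y` through its own PRIVATE crossing bond `q_n` and that right-multiplying each `U(q_n)` by its own `k_n` moves only
that factor.  Here: the multi-shear preserves `dU` (`AveragingRT.measurePreserving_mulRight`) and right-translates the CONJUGATES `Y X U(q_n)` of these loop
variables coordinatewise, so their JOINT LAW is right-invariant under the product group, hence product Haar (Weil uniqueness,
`AveragingRT.measure_eq_mass_smul_of_invariant`); `dist1` is conjugation invariant.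

WHAT THIS FILE PROVES ([folklore] measure theory; nothing of Bałaban's asserted).  §1 ★ `map_eq_pi_haar_of_mulRight` (generic: a measurable family that the
multi-shear along an indexed bond family right-translates coordinatewise is i.i.d. Haar under `dU`), `exists_conj_family` (the conjugated off-axis crossing
loop variables of one coarse bond: measurable, `dist1`-equal to the loop variables, sheared coordinatewise), ★★ `measure_small_le_haar_ball_pow`
(`dU{Small ℰ · c} ≤ h^(#T)`, `T` = the non-central transverse offsets); §2 `card_offsets` (`#T = L^{d−1} − 1`), `measure_small_le_haar_ball_pow'`,
`measure_guard_le_card_mul_pow` (`dU(guard) ≤ #PBond(j+1) · h^(L^{d−1} − 1)`), ★★ `abs_map_avgFun_real_sub_le_card_mul_pow` (the typed E6′ defect of part 6,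
sharpened); §3 at the [B10] slot `avOfPrint N S j` on `SU(N)`, every `N`, in range (`d = 3`: exponent `L² − 1`, i.e. `8` at `L = 3`):
`dU{Small · c} ≤ Haar_{SU(N)}{‖W − 1‖ < min(1∕3, π∕N)}^(L² − 1)`, `|(avOfPrint)_*(dU)(A) − dV(A)| ≤ #PBond · (the same)`, and the T-letter for every `𝔗 : TFamily₃ N L`.

HONEST FRAMING.  Sharper bookkeeping of WHERE the typed E6′ letter `Ū_*(dU) = dV` can fail (part 6: only on the guard, whose `dU`-mass is now bounded by an
`(L^{d−1} − 1)`-th power per bond); still NOT a decision of E6′ (part 6's `measure_guard_pos` stands: the guard is not `dU`-null); count-neutral; N08 NOT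
discharged; counts unmoved (typed 28∕28 · discharged 5∕27); one finite 𝕋⁴ programme at fixed ε — R4 closes the CONDITIONAL rung `BalabanLadder.UV` only; the
Yang–Mills mass gap (Clay) is NOT proved by any of this; nothing continuum ∕ ℝ³ ∕ ℝ⁴ ∕ OS ∕ mass gap.  0 `sorry`, 0 `def`, 0 `instance`, standard axioms.
-/

noncomputable section

open MeasureTheory

namespace Summit.QuantumFields.YangMills.BalabanUVNodes.N08HaarCompatibilityGuardCrossingLaw

open Literature.MathematicalPhysics.QuantumFieldTheory.Balaban1983to89
open Literature.MathematicalPhysics.QuantumFieldTheory.Balaban1983to89.T4Continuum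
open Literature.MathematicalPhysics.QuantumFieldTheory.Balaban1983to89.AveragingRT
  (axialAvg map_axialAvg measurable_axialAvg measurePreserving_mulRight measure_eq_mass_smul_of_invariant two_mul_half_add_one)
open Literature.MathematicalPhysics.QuantumFieldTheory.Balaban1983to89.BlockAveraging
  (Idx off off_bounds loopHol Small avgFun blockAvg blockAvg_avg measurableSet_small measurable_avgFun measurable_loopHol)
open Literature.MathematicalPhysics.QuantumFieldTheory.Balaban1983to89.BlockAveragingHaarAC (IsCentral)
open Summit.QuantumFields.YangMills.BalabanUVNodes.N08HaarCompatibilityGuard (avgFun_eq_axialAvg_of_not_mem_guard avOfPrint_avg_of_le)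
open Summit.QuantumFields.YangMills.BalabanUVNodes.N08HaarCompatibilityGuardCrossing

/-! ## §1. The conjugated crossing loop variables of one coarse bond are i.i.d. Haar; the product bound on the guard -/

section Law

variable {P : Params} {j : ℕ} {G : Type*} [GaugeGroup G] [MeasurableSpace G] [RegularGaugeGroup G] [HaarData G]

/-- **A RIGHT-SHEAR-EQUIVARIANT MEASURABLE FAMILY IS I.I.D. HAAR UNDER `dU`** (generic): if right-multiplying the bond variables along an indexed bond family
`qv` by `k` right-translates `Z` coordinatewise by `k`, then `Law_{dU}(Z) = Haar^ι` — the multi-shear preserves `dU` (`AveragingRT.measurePreserving_mulRight`),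
so the law is right-invariant under the product group, hence product Haar (Weil uniqueness, `AveragingRT.measure_eq_mass_smul_of_invariant`). [folklore] -/
theorem map_eq_pi_haar_of_mulRight {ι : Type*} [Fintype ι] (qv : ι → PBond P j) (Z : GaugeField P j G → ι → G) (hZ : Measurable Z)
    (hshear : ∀ (k : ι → G) (U : GaugeField P j G), Z (fun b => U b * Function.extend qv k (fun _ => 1) b) = fun i => Z U i * k i) :
    (fieldMeasure P j G).map Z = Measure.pi fun _ : ι => (HaarData.haar : Measure G) := by
  haveI : IsProbabilityMeasure ((fieldMeasure P j G).map Z) := Measure.isProbabilityMeasure_map hZ.aemeasurable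
  have h := measure_eq_mass_smul_of_invariant (Measure.pi fun _ : ι => (HaarData.haar : Measure G)) ((fieldMeasure P j G).map Z) ?_ ?_
  · rw [h, measure_univ, one_smul]
  · intro g
    exact (measurePreserving_pi (fun _ : ι => (HaarData.haar : Measure G)) (fun _ => HaarData.haar)
      (f := fun i x => g i * x) (fun i => ⟨measurable_const_mul (g i), HaarData.map_mul_left (g i)⟩)).map_eq
  · intro g
    set R : GaugeField P j G → GaugeField P j G := fun U b => U b * Function.extend qv g (fun _ => 1) b with hR
    have hRmp : MeasurePreserving R (fieldMeasure P j G) (fieldMeasure P j G) := measurePreserving_mulRight _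
    have hcomp : (fun x => x * g) ∘ Z = Z ∘ R := by
      funext U
      show Z U * g = Z (R U)
      rw [hR, hshear]
      rfl
    rw [Measure.map_map (measurable_mul_const g) hZ, hcomp, ← Measure.map_map hZ hRmp.measurable, hRmp.map_eq]

omit [HaarData G] in
/-- **THE CONJUGATED OFF-AXIS CROSSING LOOP VARIABLES OF ONE COARSE BOND**: a measurable family `Z U r` (`r` = the non-central transverse offsets,
loop index `(r, 1, 1)`), each a CONJUGATE of the loop variable (`dist1 (Z U r) = dist1 (U(loop_r))`), which the multi-shear at the crossing bonds
right-translates coordinatewise (`loopHol_mulRight_extend`; standing range). [cite: Balaban1987RG1, (0.4) p.253 (bookkeeping)] -/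
theorem exists_conj_family (hj : j + 1 ≤ P.m + P.K) (c : PBond P (j + 1)) :
    ∃ Z : GaugeField P j G → {r : Fin P.d → Fin P.L // off r c.dir = 0 ∧ ¬ IsCentral c (r, 1, 1)} → G,
      Measurable Z ∧ (∀ U r, dist1 (Z U r) = dist1 (loopHol U c (r.1, 1, 1))) ∧
        ∀ (k : {r : Fin P.d → Fin P.L // off r c.dir = 0 ∧ ¬ IsCentral c (r, 1, 1)} → G) (U : GaugeField P j G),
          Z (fun b => U b * Function.extend
              (fun r : {r : Fin P.d → Fin P.L // off r c.dir = 0 ∧ ¬ IsCentral c (r, 1, 1)} =>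
                (⟨walkEnd (emb c.src) (stairWord 1 (off r.1) ++ List.replicate ((P.L - 1) / 2) (c.dir, true)), c.dir⟩ : PBond P j))
              k (fun _ => 1) b) = fun r => Z U r * k r := by
  -- the three factors of `Y` and the whole `Y`
  let Y : GaugeField P j G → (Fin P.d → Fin P.L) → G := fun V r =>
    holAt V (walk (walkEnd (emb c.src) (stairWord 1 (off r) ++ List.replicate ((P.L - 1) / 2 + 1) (c.dir, true)))
        (List.replicate (P.L - 1 - (P.L - 1) / 2) (c.dir, true))) *
      holAt V (walk (walkEnd (walkEnd (emb c.src) (stairWord 1 (off r))) (List.replicate P.L (c.dir, true))) (wordRev (stairWord 1 (off r)))) *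
    (axialAvg V c)⁻¹
  refine ⟨fun U r => Y U r.1 * loopHol U c (r.1, 1, 1) * (Y U r.1)⁻¹, ?_, ?_, ?_⟩
  · refine measurable_pi_lambda _ fun r => ?_
    have hY : Measurable fun U : GaugeField P j G => Y U r.1 :=
      ((measurable_holAt _).mul (measurable_holAt _)).mul ((measurable_pi_apply c).comp measurable_axialAvg).inv
    exact (hY.mul ((measurable_pi_apply _).comp (measurable_loopHol c))).mul hY.inv
  · intro U r
    exact GaugeGroup.dist1_conj _ _
  · intro k U
    funext r
    -- the crossing-bond family of this proof, BY NAME for the §2–§3 lemmas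
    have hqv : ∀ r' : {r : Fin P.d → Fin P.L // off r c.dir = 0 ∧ ¬ IsCentral c (r, 1, 1)},
        (fun r : {r : Fin P.d → Fin P.L // off r c.dir = 0 ∧ ¬ IsCentral c (r, 1, 1)} =>
            (⟨walkEnd (emb c.src) (stairWord 1 (off r.1) ++ List.replicate ((P.L - 1) / 2) (c.dir, true)), c.dir⟩ : PBond P j)) r' =
          ⟨walkEnd (emb c.src) (stairWord 1 (off ((fun r : {r : Fin P.d → Fin P.L // off r c.dir = 0 ∧ ¬ IsCentral c (r, 1, 1)} => r.1) r')) ++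
            List.replicate ((P.L - 1) / 2) (c.dir, true)), c.dir⟩ := fun _ => rfl
    have h0 : ∀ r' : {r : Fin P.d → Fin P.L // off r c.dir = 0 ∧ ¬ IsCentral c (r, 1, 1)},
        off ((fun r : {r : Fin P.d → Fin P.L // off r c.dir = 0 ∧ ¬ IsCentral c (r, 1, 1)} => r.1) r') c.dir = 0 := fun r' => r'.2.1
    have hc : ∀ r' : {r : Fin P.d → Fin P.L // off r c.dir = 0 ∧ ¬ IsCentral c (r, 1, 1)},
        ¬ IsCentral c ((fun r : {r : Fin P.d → Fin P.L // off r c.dir = 0 ∧ ¬ IsCentral c (r, 1, 1)} => r.1) r', 1, 1) := fun r' => r'.2.2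
    have hYeq : Y (fun b => U b * Function.extend
        (fun r : {r : Fin P.d → Fin P.L // off r c.dir = 0 ∧ ¬ IsCentral c (r, 1, 1)} =>
          (⟨walkEnd (emb c.src) (stairWord 1 (off r.1) ++ List.replicate ((P.L - 1) / 2) (c.dir, true)), c.dir⟩ : PBond P j))
        k (fun _ => 1) b) r.1 = Y U r.1 := by
      show _ * _ * _ = _ * _ * _
      rw [holAt_mulRight_extend_of_forall_ne _ U k fun s hs i' => ne_cross_of_mem_walk_suffix c _ _ hqv h0 hj r hs i',
        holAt_mulRight_extend_of_forall_ne _ U k fun s hs i' => ne_cross_of_mem_walk_wordRev_stairWord c _ _ hqv (h0 r) 1 _ hs _,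
        axialAvg_mulRight_extend c _ _ hqv hj hc]
    show Y _ r.1 * loopHol _ c (r.1, 1, 1) * (Y _ r.1)⁻¹ = Y U r.1 * loopHol U c (r.1, 1, 1) * (Y U r.1)⁻¹ * k r
    rw [hYeq, loopHol_mulRight_extend c _ _ hqv h0 hj Subtype.val_injective hc U k r, loopHol_eq_mul_apply_cross_mul c _ _ hqv U r]
    show Y U r.1 * (_ * (U _ * k r) * Y U r.1) * (Y U r.1)⁻¹ = Y U r.1 * (_ * U _ * Y U r.1) * (Y U r.1)⁻¹ * k r
    group

variable (ℰ : LoopAverage G)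

/-- **THE SMALL-FIELD GUARD OF ONE COARSE BOND COSTS A PRODUCT**: `dU{Small ℰ · c} ≤ Haar{g | dist1 g < δ}^(#T)`, `T` = the non-central transverse offsets
— the guard asks ALL `(d!)²L^d` loop variables within `δ` of `1`, in particular the `#T` off-axis crossing ones, whose conjugates are i.i.d. Haar.
[cite: Balaban1987RG1, (0.4) p.253 (the guard of the typed log; bookkeeping)] -/
theorem measure_small_le_haar_ball_pow (hj : j + 1 ≤ P.m + P.K) (c : PBond P (j + 1)) :
    fieldMeasure P j G {U : GaugeField P j G | Small ℰ U c} ≤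
      HaarData.haar {g : G | dist1 g < ℰ.δ} ^ Fintype.card {r : Fin P.d → Fin P.L // off r c.dir = 0 ∧ ¬ IsCentral c (r, 1, 1)} := by
  obtain ⟨Z, hZm, hdist, hshear⟩ := exists_conj_family (G := G) hj c
  have hlaw := map_eq_pi_haar_of_mulRight _ Z hZm hshear
  have hball : MeasurableSet {g : G | dist1 g < ℰ.δ} := measurableSet_lt RegularGaugeGroup.measurable_dist1 measurable_const
  have hsub : {U : GaugeField P j G | Small ℰ U c} ⊆ Z ⁻¹' Set.pi Set.univ (fun _ => {g : G | dist1 g < ℰ.δ}) := by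
    intro U hU r _
    show dist1 (Z U r) < ℰ.δ
    rw [hdist]
    exact hU _
  calc fieldMeasure P j G {U : GaugeField P j G | Small ℰ U c}
      ≤ fieldMeasure P j G (Z ⁻¹' Set.pi Set.univ (fun _ => {g : G | dist1 g < ℰ.δ})) := measure_mono hsub
    _ = (fieldMeasure P j G).map Z (Set.pi Set.univ fun _ => {g : G | dist1 g < ℰ.δ}) :=
        (Measure.map_apply hZm (MeasurableSet.univ_pi fun _ => hball)).symm
    _ = ∏ _r : {r : Fin P.d → Fin P.L // off r c.dir = 0 ∧ ¬ IsCentral c (r, 1, 1)}, HaarData.haar {g : G | dist1 g < ℰ.δ} := by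
        rw [hlaw, Measure.pi_pi]
    _ = HaarData.haar {g : G | dist1 g < ℰ.δ} ^ Fintype.card {r : Fin P.d → Fin P.L // off r c.dir = 0 ∧ ¬ IsCentral c (r, 1, 1)} := by
        rw [Finset.prod_const, Finset.card_univ]

end Law

/-! ## §2. `#T = L^{d−1} − 1`; the guard and the typed E6′ defect of part 6, sharpened -/

section Count

variable {P : Params} {j : ℕ}

/-- `off r ν = 0` iff `r ν` is the central label `(L−1)∕2`. [folklore] -/
theorem off_eq_zero_iff (r : Fin P.d → Fin P.L) (ν : Fin P.d) :
    off r ν = 0 ↔ r ν = ⟨(P.L - 1) / 2, by have := two_mul_half_add_one P; omega⟩ := by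
  rw [Fin.ext_iff]
  simp only [off, sub_eq_zero, Nat.cast_inj]

/-- **THE NUMBER OF NON-CENTRAL TRANSVERSE OFFSETS IS `L^{d−1} − 1`** (functions `Fin d → Fin L` with the central value at `μ`, minus the centre).
[folklore] -/
theorem card_offsets (c : PBond P (j + 1)) :
    Fintype.card {r : Fin P.d → Fin P.L // off r c.dir = 0 ∧ ¬ IsCentral c (r, 1, 1)} = P.L ^ (P.d - 1) - 1 := by
  classical
  have hL := two_mul_half_add_one P
  set m₀ : Fin P.L := ⟨(P.L - 1) / 2, by omega⟩ with hm₀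
  -- the predicate, rewritten on labels
  have hiff : ∀ r : Fin P.d → Fin P.L, (off r c.dir = 0 ∧ ¬ IsCentral c (r, 1, 1)) ↔ (r c.dir = m₀ ∧ r ≠ fun _ => m₀) := by
    intro r
    rw [off_eq_zero_iff]
    refine and_congr_right fun hμ => not_congr ?_
    constructor
    · intro h
      funext ν
      by_cases hν : ν = c.dir
      · rw [hν, hμ]
      · exact (off_eq_zero_iff r ν).1 (h ν hν)
    · intro h ν _
      rw [off_eq_zero_iff, h]
  have hcard : Fintype.card {r : Fin P.d → Fin P.L // off r c.dir = 0 ∧ ¬ IsCentral c (r, 1, 1)} =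
      Fintype.card {r : Fin P.d → Fin P.L // r c.dir = m₀ ∧ r ≠ fun _ => m₀} :=
    Fintype.card_congr (Equiv.subtypeEquivRight hiff)
  -- remove the centre
  have herase : Fintype.card {r : Fin P.d → Fin P.L // r c.dir = m₀ ∧ r ≠ fun _ => m₀} =
      Fintype.card {r : Fin P.d → Fin P.L // r c.dir = m₀} - 1 := by
    rw [Fintype.card_subtype, Fintype.card_subtype]
    have : (Finset.univ.filter fun r : Fin P.d → Fin P.L => r c.dir = m₀ ∧ r ≠ fun _ => m₀) =
        (Finset.univ.filter fun r : Fin P.d → Fin P.L => r c.dir = m₀).erase (fun _ => m₀) := by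
      ext r
      simp only [Finset.mem_filter, Finset.mem_univ, true_and, Finset.mem_erase]
      tauto
    rw [this, Finset.card_erase_of_mem (by simp)]
  -- the fibre over the central value at `μ` is `({ν // ν ≠ μ} → Fin L)`
  have hfib : Fintype.card {r : Fin P.d → Fin P.L // r c.dir = m₀} = P.L ^ (P.d - 1) := by
    have hof : ∀ f : {ν : Fin P.d // ν ≠ c.dir} → Fin P.L, (fun ν => if h : ν = c.dir then m₀ else f ⟨ν, h⟩) c.dir = m₀ :=
      fun f => dif_pos rfl
    have e : {r : Fin P.d → Fin P.L // r c.dir = m₀} ≃ ({ν : Fin P.d // ν ≠ c.dir} → Fin P.L) :=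
      { toFun := fun r ν => r.1 ν.1
        invFun := fun f => ⟨fun ν => if h : ν = c.dir then m₀ else f ⟨ν, h⟩, hof f⟩
        left_inv := fun r => by
          apply Subtype.ext
          funext ν
          show (if h : ν = c.dir then m₀ else r.1 ν) = r.1 ν
          by_cases h : ν = c.dir
          · rw [dif_pos h, h]; exact r.2.symm
          · rw [dif_neg h]
        right_inv := fun f => by
          funext ν
          show (if h : ν.1 = c.dir then m₀ else f ⟨ν.1, h⟩) = f ν
          rw [dif_neg ν.2] }
    rw [Fintype.card_congr e, Fintype.card_fun, Fintype.card_fin, Fintype.card_subtype_compl, Fintype.card_fin, Fintype.card_subtype_eq]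
  rw [hcard, herase, hfib]

end Count

section Sharpened

variable {P : Params} {j : ℕ} {G : Type*} [GaugeGroup G] [MeasurableSpace G] [RegularGaugeGroup G] [HaarData G] (ℰ : LoopAverage G)

/-- **`dU{Small ℰ · c} ≤ Haar{dist1 < δ}^(L^{d−1} − 1)`**. [cite: Balaban1987RG1, (0.4) p.253 (the guard of the typed log; bookkeeping)] -/
theorem measure_small_le_haar_ball_pow' (hj : j + 1 ≤ P.m + P.K) (c : PBond P (j + 1)) :
    fieldMeasure P j G {U : GaugeField P j G | Small ℰ U c} ≤ HaarData.haar {g : G | dist1 g < ℰ.δ} ^ (P.L ^ (P.d - 1) - 1) := by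
  rw [← card_offsets c]
  exact measure_small_le_haar_ball_pow ℰ hj c

/-- **`dU(guard) ≤ #PBond(j+1) · Haar{dist1 < δ}^(L^{d−1} − 1)`** (union bound over the coarse bonds; part 6's `measure_guard_le` had exponent `1`).
[cite: Balaban1987RG1, (0.4) p.253 (bookkeeping)] -/
theorem measure_guard_le_card_mul_pow (hj : j + 1 ≤ P.m + P.K) :
    fieldMeasure P j G {U : GaugeField P j G | ∃ c : PBond P (j + 1), Small ℰ U c} ≤
      Fintype.card (PBond P (j + 1)) * HaarData.haar {g : G | dist1 g < ℰ.δ} ^ (P.L ^ (P.d - 1) - 1) := by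
  rw [Set.setOf_exists]
  calc fieldMeasure P j G (⋃ c : PBond P (j + 1), {U : GaugeField P j G | Small ℰ U c})
      ≤ ∑ c : PBond P (j + 1), fieldMeasure P j G {U : GaugeField P j G | Small ℰ U c} := measure_iUnion_fintype_le _ _
    _ ≤ ∑ _c : PBond P (j + 1), HaarData.haar {g : G | dist1 g < ℰ.δ} ^ (P.L ^ (P.d - 1) - 1) :=
        Finset.sum_le_sum fun c _ => measure_small_le_haar_ball_pow' ℰ hj c
    _ = Fintype.card (PBond P (j + 1)) * HaarData.haar {g : G | dist1 g < ℰ.δ} ^ (P.L ^ (P.d - 1) - 1) := by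
        rw [Finset.sum_const, Finset.card_univ, nsmul_eq_mul]

/-- **THE TYPED E6′ DEFECT, SHARPENED**: `|Ū_*(dU)(A) − dV(A)| ≤ #PBond(j+1) · Haar{dist1 < δ}^(L^{d−1} − 1)` for every measurable `A`, every measurable
small-loop average, standing range (part 6's `abs_map_avgFun_real_sub_le` + `measure_guard_le_card_mul_pow`).
[cite: Balaban1987RG1, (0.4) p.253 (bookkeeping; E6′ itself NOT IN PRINT)] -/
theorem abs_map_avgFun_real_sub_le_card_mul_pow (hj : j + 1 ≤ P.m + P.K) (hE : ∀ n, Measurable fun W : Fin (n + 1) → G => ℰ.E W)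
    {A : Set (GaugeField P (j + 1) G)} (hA : MeasurableSet A) :
    |((fieldMeasure P j G).map (avgFun ℰ)).real A - (fieldMeasure P (j + 1) G).real A| ≤
      Fintype.card (PBond P (j + 1)) * (HaarData.haar : Measure G).real {g : G | dist1 g < ℰ.δ} ^ (P.L ^ (P.d - 1) - 1) := by
  refine (N08HaarCompatibilityGuard.abs_map_avgFun_real_sub_le ℰ hj hE hA).trans ?_
  have h := measure_guard_le_card_mul_pow ℰ hj (G := G)
  have hne : (Fintype.card (PBond P (j + 1)) : ENNReal) * HaarData.haar {g : G | dist1 g < ℰ.δ} ^ (P.L ^ (P.d - 1) - 1) ≠ ⊤ :=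
    ENNReal.mul_ne_top (ENNReal.natCast_ne_top _) (ENNReal.pow_ne_top (measure_ne_top _ _))
  have := ENNReal.toReal_mono hne h
  rwa [ENNReal.toReal_mul, ENNReal.toReal_natCast, ENNReal.toReal_pow] at this

end Sharpened

/-! ## §3. The typed E6′ defect on bounded observables (the `Setup.IsRT` letter shape) -/

section IntegralForm

variable {P : Params} {j : ℕ} {G : Type*} [GaugeGroup G] [MeasurableSpace G] [RegularGaugeGroup G] [HaarData G] (ℰ : LoopAverage G)

/-- **THE TYPED E6′ DEFECT ON BOUNDED OBSERVABLES**: `|∫ f(Ū U) dU − ∫ f dV| ≤ 2C · dU(guard)` for every measurable `f` with `|f| ≤ C` (standing range):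
the integrand `f∘Ū − f∘axial` vanishes off the guard and `axial_*(dU) = dV`. [cite: Balaban1987RG1, (0.4) p.253 (bookkeeping; E6′ NOT IN PRINT)] -/
theorem abs_integral_comp_avgFun_sub_le (hj : j + 1 ≤ P.m + P.K) (hE : ∀ n, Measurable fun W : Fin (n + 1) → G => ℰ.E W)
    {f : GaugeField P (j + 1) G → ℝ} (hf : Measurable f) {C : ℝ} (hC : ∀ V, |f V| ≤ C) :
    |∫ U, f (avgFun ℰ U) ∂(fieldMeasure P j G) - ∫ V, f V ∂(fieldMeasure P (j + 1) G)| ≤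
      2 * C * (fieldMeasure P j G).real {U : GaugeField P j G | ∃ c : PBond P (j + 1), Small ℰ U c} := by
  have h1 : ∫ V, f V ∂(fieldMeasure P (j + 1) G) = ∫ U, f (axialAvg U) ∂(fieldMeasure P j G) := by
    rw [← map_axialAvg (G := G) hj, integral_map measurable_axialAvg.aemeasurable hf.aestronglyMeasurable]
  have hi1 : Integrable (fun U : GaugeField P j G => f (avgFun ℰ U)) (fieldMeasure P j G) :=
    Integrable.of_bound (hf.comp (measurable_avgFun ℰ hE)).aestronglyMeasurable C (ae_of_all _ fun U => by simpa using hC _)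
  have hi2 : Integrable (fun U : GaugeField P j G => f (axialAvg U)) (fieldMeasure P j G) :=
    Integrable.of_bound (hf.comp measurable_axialAvg).aestronglyMeasurable C (ae_of_all _ fun U => by simpa using hC _)
  rw [h1, ← integral_sub hi1 hi2,
    ← setIntegral_eq_integral_of_forall_compl_eq_zero (s := {U : GaugeField P j G | ∃ c : PBond P (j + 1), Small ℰ U c})
      (fun U hU => by rw [avgFun_eq_axialAvg_of_not_mem_guard ℰ hU, sub_self]), ← Real.norm_eq_abs]
  refine norm_setIntegral_le_of_norm_le_const (measure_lt_top _ _) fun U _ => ?_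
  calc ‖f (avgFun ℰ U) - f (axialAvg U)‖ ≤ ‖f (avgFun ℰ U)‖ + ‖f (axialAvg U)‖ := norm_sub_le _ _
    _ ≤ C + C := add_le_add (by simpa using hC _) (by simpa using hC _)
    _ = 2 * C := by ring

/-- … in the T-letters: for EVERY version `T` of (10) along `blockAvg ℰ`, `|∫ T1·f dV − ∫ f dV| ≤ 2C · dU(guard)` (`Setup.IsRT` at the constant density).
[cite: Balaban1985Averaging, (10) p.19; Balaban1987RG1, (0.4) p.253 (bookkeeping; «T1 = 1» NOT IN PRINT)] -/
theorem abs_integral_T_one_mul_sub_le (hj : j + 1 ≤ P.m + P.K) (hE : ∀ n, Measurable fun W : Fin (n + 1) → G => ℰ.E W)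
    (T : RTOpI P j G (blockAvg ℰ)) {f : GaugeField P (j + 1) G → ℝ} (hf : Measurable f) {C : ℝ} (hC : ∀ V, |f V| ≤ C) :
    |∫ V, T.T 1 V * f V ∂(fieldMeasure P (j + 1) G) - ∫ V, f V ∂(fieldMeasure P (j + 1) G)| ≤
      2 * C * (fieldMeasure P j G).real {U : GaugeField P j G | ∃ c : PBond P (j + 1), Small ℰ U c} := by
  have h := T.isRT 1 (integrable_const _) f hf ⟨C, hC⟩
  simp only [blockAvg_avg, Pi.one_apply, one_mul] at h
  rw [h]
  exact abs_integral_comp_avgFun_sub_le ℰ hj hE hf hC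

/-- **… WITH THE PRODUCT BOUND**: `|∫ f(Ū U) dU − ∫ f dV| ≤ 2C · #PBond(j+1) · Haar{dist1 < δ}^(L^{d−1} − 1)`.
[cite: Balaban1987RG1, (0.4) p.253 (bookkeeping; E6′ NOT IN PRINT)] -/
theorem abs_integral_comp_avgFun_sub_le_card_mul_pow (hj : j + 1 ≤ P.m + P.K) (hE : ∀ n, Measurable fun W : Fin (n + 1) → G => ℰ.E W)
    {f : GaugeField P (j + 1) G → ℝ} (hf : Measurable f) {C : ℝ} (hC : ∀ V, |f V| ≤ C) :
    |∫ U, f (avgFun ℰ U) ∂(fieldMeasure P j G) - ∫ V, f V ∂(fieldMeasure P (j + 1) G)| ≤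
      2 * C * (Fintype.card (PBond P (j + 1)) * (HaarData.haar : Measure G).real {g : G | dist1 g < ℰ.δ} ^ (P.L ^ (P.d - 1) - 1)) := by
  have hC0 : 0 ≤ C := (abs_nonneg _).trans (hC 1)
  refine (abs_integral_comp_avgFun_sub_le ℰ hj hE hf hC).trans (mul_le_mul_of_nonneg_left ?_ (by positivity))
  have h := measure_guard_le_card_mul_pow ℰ hj (G := G)
  have hne : (Fintype.card (PBond P (j + 1)) : ENNReal) * HaarData.haar {g : G | dist1 g < ℰ.δ} ^ (P.L ^ (P.d - 1) - 1) ≠ ⊤ :=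
    ENNReal.mul_ne_top (ENNReal.natCast_ne_top _) (ENNReal.pow_ne_top (measure_ne_top _ _))
  have := ENNReal.toReal_mono hne h
  rwa [ENNReal.toReal_mul, ENNReal.toReal_natCast, ENNReal.toReal_pow] at this

end IntegralForm

/-! ## §4. At the [B10] slot's averaging `avOfPrint N S j` on `SU(N)` (`d = 3`: exponent `L² − 1`) -/

section Slot

open Literature.MathematicalPhysics.QuantumFieldTheory.Balaban1985CMP102.Setting (Scales)
open Literature.MathematicalPhysics.QuantumFieldTheory.Balaban1983to89.B10RunsOfRecord (avOfPrint TOfPrint)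
open Literature.MathematicalPhysics.QuantumFieldTheory.Balaban1983to89.B10Eq2HaarCompatibility
open Literature.MathematicalPhysics.QuantumFieldTheory.Balaban1983to89.ExpMeanLog (expMeanLogSU expMeanLogSU_δ measurable_expMeanLogSU_E)
open Literature.MathematicalPhysics.QuantumFieldTheory.Balaban1983to89.Node00 (SU TFamily₃)

variable (N : ℕ) [NeZero N] {L : ℕ}

/-- **THE SLOT'S GUARD COSTS A PRODUCT**: `dU{Small · c} ≤ Haar_{SU(N)}{‖W − 1‖ < min(1∕3, π∕N)}^(L² − 1)` at every coarse bond of every in-range level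
(`= 8` off-axis crossing loops at `L = 3`). [cite: Balaban1987RG1, (0.4) p.253 (bookkeeping)] -/
theorem measure_small_avOfPrint_le_pow (S : Scales L) {j : ℕ} (hj : j + 1 ≤ S.P.m + S.P.K) (c : PBond S.P (j + 1)) :
    fieldMeasure S.P j (SU N) {U : GaugeField S.P j (SU N) | Small (expMeanLogSU : LoopAverage (SU N)) U c} ≤
      (HaarData.haar : Measure (SU N)) {g : SU N | dist1 g < min (1 / 3) (Real.pi / N)} ^ (L ^ 2 - 1) := by
  have h := measure_small_le_haar_ball_pow' (expMeanLogSU : LoopAverage (SU N)) hj c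
  rwa [expMeanLogSU_δ, Fintype.card_fin] at h

/-- **THE SLOT'S GUARD EVENT**: `dU(guard) ≤ #PBond(j+1) · Haar_{SU(N)}{‖W − 1‖ < min(1∕3, π∕N)}^(L² − 1)`. [cite: Balaban1987RG1, (0.4) p.253 (bookkeeping)] -/
theorem measure_guard_avOfPrint_le_card_mul_pow (S : Scales L) {j : ℕ} (hj : j + 1 ≤ S.P.m + S.P.K) :
    fieldMeasure S.P j (SU N) {U : GaugeField S.P j (SU N) | ∃ c : PBond S.P (j + 1), Small (expMeanLogSU : LoopAverage (SU N)) U c} ≤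
      Fintype.card (PBond S.P (j + 1)) * (HaarData.haar : Measure (SU N)) {g : SU N | dist1 g < min (1 / 3) (Real.pi / N)} ^ (L ^ 2 - 1) := by
  have h := measure_guard_le_card_mul_pow (expMeanLogSU : LoopAverage (SU N)) hj
  rwa [expMeanLogSU_δ, Fintype.card_fin] at h

/-- **THE TYPED E6′ DEFECT AT THE SLOT, SHARPENED**: `|(avOfPrint)_*(dU)(A) − dV(A)| ≤ #PBond(j+1) · Haar_{SU(N)}{‖W − 1‖ < min(1∕3, π∕N)}^(L² − 1)`,
standing range, every `N`, every measurable `A` (beyond the range the left side is `0`, p434996).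
[cite: Balaban1987RG1, (0.4) p.253; Balaban1985UV3, (2) p.256 (bookkeeping; E6′ NOT IN PRINT)] -/
theorem abs_map_avOfPrint_real_sub_le_card_mul_pow (S : Scales L) {j : ℕ} (hj : j + 1 ≤ S.P.m + S.P.K)
    {A : Set (GaugeField S.P (j + 1) (SU N))} (hA : MeasurableSet A) :
    |((fieldMeasure S.P j (SU N)).map (avOfPrint N S j).avg).real A - (fieldMeasure S.P (j + 1) (SU N)).real A| ≤
      Fintype.card (PBond S.P (j + 1)) *
        (HaarData.haar : Measure (SU N)).real {g : SU N | dist1 g < min (1 / 3) (Real.pi / N)} ^ (L ^ 2 - 1) := by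
  have h := abs_map_avgFun_real_sub_le_card_mul_pow (expMeanLogSU : LoopAverage (SU N)) hj measurable_expMeanLogSU_E hA
  rwa [← avOfPrint_avg_of_le N S hj, expMeanLogSU_δ, Fintype.card_fin] at h

variable (L) in
/-- **THE T-LETTER OF THE SLOT, SHARPENED**: for EVERY transformation family `𝔗 : Node00.TFamily₃ N L`, every member, in-range level and measurable `A`:
`|∫_A (𝔗 S j).T 1 dV − dV(A)| ≤ #PBond(j+1) · Haar_{SU(N)}{‖W − 1‖ < min(1∕3, π∕N)}^(L² − 1)`.
[cite: Balaban1985Averaging, (10) p.19; Balaban1987RG1, (0.4) p.253 (bookkeeping; «T1 = 1» NOT IN PRINT)] -/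
theorem abs_setIntegral_TFamily_one_sub_le_card_mul_pow (𝔗 : TFamily₃ N L) (S : Scales L) {j : ℕ} (hj : j + 1 ≤ S.P.m + S.P.K)
    {A : Set (GaugeField S.P (j + 1) (SU N))} (hA : MeasurableSet A) :
    |∫ V in A, (𝔗 S j).T 1 V ∂(fieldMeasure S.P (j + 1) (SU N)) - (fieldMeasure S.P (j + 1) (SU N)).real A| ≤
      Fintype.card (PBond S.P (j + 1)) *
        (HaarData.haar : Measure (SU N)).real {g : SU N | dist1 g < min (1 / 3) (Real.pi / N)} ^ (L ^ 2 - 1) := by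
  rw [setIntegral_T_one (𝔗 S j) (measurable_avOfPrint N S j) hA, ← Measure.map_apply (measurable_avOfPrint N S j) hA]
  exact abs_map_avOfPrint_real_sub_le_card_mul_pow N S hj hA

variable (L) in
/-- **THE T-LETTER ON BOUNDED OBSERVABLES AT THE SLOT**: for EVERY transformation family `𝔗`, member, in-range level and measurable `f` with `|f| ≤ C`:
`|∫ (𝔗 S j).T 1 · f dV − ∫ f dV| ≤ 2C · #PBond(j+1) · Haar_{SU(N)}{‖W − 1‖ < min(1∕3, π∕N)}^(L² − 1)` — the `Setup.IsRT` shape of «T1 = 1» up to the guard.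
[cite: Balaban1985Averaging, (10) p.19; Balaban1987RG1, (0.4) p.253 (bookkeeping; «T1 = 1» NOT IN PRINT)] -/
theorem abs_integral_TFamily_one_mul_sub_le_card_mul_pow (𝔗 : TFamily₃ N L) (S : Scales L) {j : ℕ} (hj : j + 1 ≤ S.P.m + S.P.K)
    {f : GaugeField S.P (j + 1) (SU N) → ℝ} (hf : Measurable f) {C : ℝ} (hC : ∀ V, |f V| ≤ C) :
    |∫ V, (𝔗 S j).T 1 V * f V ∂(fieldMeasure S.P (j + 1) (SU N)) - ∫ V, f V ∂(fieldMeasure S.P (j + 1) (SU N))| ≤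
      2 * C * (Fintype.card (PBond S.P (j + 1)) *
        (HaarData.haar : Measure (SU N)).real {g : SU N | dist1 g < min (1 / 3) (Real.pi / N)} ^ (L ^ 2 - 1)) := by
  have h := (𝔗 S j).isRT 1 (integrable_const _) f hf ⟨C, hC⟩
  simp only [Pi.one_apply, one_mul] at h
  rw [h, avOfPrint_avg_of_le N S hj]
  have h2 := abs_integral_comp_avgFun_sub_le_card_mul_pow (expMeanLogSU : LoopAverage (SU N)) hj measurable_expMeanLogSU_E hf hC
  rwa [expMeanLogSU_δ, Fintype.card_fin] at h2

end Slot

end Summit.QuantumFields.YangMills.BalabanUVNodes.N08HaarCompatibilityGuardCrossingLaw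

end
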